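import Summits.MatrixMultiplication.MatrixMultiplication.Theorems.SaturationLadderCornerBandCore
import Summits.MatrixMultiplication.MatrixMultiplication.Theorems.SaturationLadderTwinCeiling
import HarnessLib

/-!
# SaturationLadder — Kernel XXVIII (ii): every pencil member is an exact value of `ω(1,·,·)` on the sharp band

Support for the deciding crux `SubexpSaturation` (h₁, item 25909) of `Theses/SaturationLadder.lean`
(cell `decomp-mm`, lens «grading / quantitative ladder», gen 56).  No definitions, no named facts,
no `sorry`.  Second file of `…CornerBandCore → …CornerBand → …CornerFamily`.

For the pencil member `κ = p/q ∈ [0,1]` at scale `j` — letter counts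
`(n₁, …, n₆) = (3qj+2q, 2qj·2^{j+1} − (3qj+2q+2p), 3qj+2q+2p, qj−2q, 0, 2qj)` — this file turns the
sharp-band cores `bandCoreY` / `bandCoreX` into

* `bandY` / `bandX`: the two entropy hypotheses of the exact six-type theorem
  `omegaRect_one_tw_exact`, under the INTEGER BAND CONDITION
  `hA : c₁(p/q)·j + 2 ≤ j²·δ(p/q)` and `j ≥ 16` (`j⁴ ≤ 2^j`, `pow_four_le_two_pow`) — replacing the
  regime `j ≥ 1000 ∧ j·δ ≥ 30` of `paramY` / `paramX`
  (`Theorems/SaturationLadderTwinCeilingPencil.lean`);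
* `band_tight`: **`ω(1, t_j, r_j) = 1 + r_j`** (`≤`; `≥` is the generic lower bound) at
  `t_j = j n₁ / ((j+1) n₃)`, `r_j = ((j+1) n₂ + n₁ + n₄) / ((j+1) n₃)`, for every such `(p, q, j)`;
* the size and defect of these points: `r_j ≤ (2/3)·2^{j+1}` (`r_le_two_thirds`), `t_j < 1`,
  `0 ≤ t_j`, and **`(1 − t_j)·log r_j ≤ ((3q+2p)/(3q))·log 2 = log θ(p/q)`** (`band_defect_le`): the
  defect of every exact point of the pencil is at most the logarithm of ITS OWN family constant
  `θ(κ) = 2^{1+2κ/3}`, uniformly in `j`.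

As `κ ↓ κ₀ = 0.80482…` (the zero of `δ`) along the band, `log θ(κ) ↓ (1 + 2κ₀/3) log 2 =
(5 log 5 − 7 log 2)/3 = 1.0650…` — the twin-class ceiling (`GaugeConeClasses.lean`,
`clause_above_classCeiling`); the next file exhibits the explicit CORNER FAMILY doing this.

References: D. Coppersmith, S. Winograd, J. Symbolic Comput. 9 (1990) §8 (key
`CoppersmithWinograd1990`); J. Alman, R. Duan, V. Vassilevska Williams, Y. Xu, Z. Xu, R. Zhou, SODA
2025, §3.4 (key `AlmanDuanVassilevskaWilliamsXuXuZhou2025`).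
-/

set_option linter.dupNamespace false
-- (single-conjunct summit: the namespace repeats `MatrixMultiplication`)

noncomputable section

namespace Summit.MatrixMultiplication.MatrixMultiplication.Theorems.SaturationLadderCornerBand

open Literature.Computability.AlgebraicComplexity
open Summit.MatrixMultiplication.MatrixMultiplication.Theorems.SaturationLadderCornerBandCore
  (bandCoreY bandCoreX)
open Summit.MatrixMultiplication.MatrixMultiplication.Theorems.SaturationLadderTwinCeilingPencil
open Summit.MatrixMultiplication.MatrixMultiplication.Theorems.SaturationLadderTwinExact
  (omegaRect_one_tw_exact)
open Summit.MatrixMultiplication.MatrixMultiplication.Theorems.SaturationLadderTwinCeiling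
  (rEq one_le_r r_le)

/-! ## `j⁴ ≤ 2^j` from `j = 16` on (so `2 ≤ ε⁴ B` with `ε = 1/j`, `B = 2^{j+1}`) -/

/-- `j⁴ ≤ 2^j` for `j ≥ 16` (equality at `16`). [folklore] -/
theorem pow_four_le_two_pow (j : ℕ) (hj : 16 ≤ j) : j ^ 4 ≤ 2 ^ j := by
  induction j, hj using Nat.le_induction with
  | base => norm_num
  | succ n hn ih =>
    have h1 : 16 * n ^ 3 ≤ n ^ 4 := by
      calc 16 * n ^ 3 ≤ n * n ^ 3 := Nat.mul_le_mul_right _ hn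
        _ = n ^ 4 := by ring
    have h2 : 16 * n ^ 2 ≤ n ^ 3 := by
      calc 16 * n ^ 2 ≤ n * n ^ 2 := Nat.mul_le_mul_right _ hn
        _ = n ^ 3 := by ring
    have h3 : 16 * n ≤ n ^ 2 := by
      calc 16 * n ≤ n * n := Nat.mul_le_mul_right _ hn
        _ = n ^ 2 := by ring
    have e : (n + 1) ^ 4 = n ^ 4 + 4 * n ^ 3 + 6 * n ^ 2 + 4 * n + 1 := by ring
    rw [e, pow_succ 2 n]
    linarith

/-- The integer band condition `c₁ j + 2 ≤ j² δ` in the form `c₁ ε + 2ε² ≤ δ`, `ε = 1/j`.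
[folklore] -/
theorem band_eps {c δ : ℝ} {j : ℕ} (hj : 0 < j) (hA : c * j + 2 ≤ (j : ℝ) ^ 2 * δ) :
    c * (1 / (j : ℝ)) + 2 * (1 / (j : ℝ)) ^ 2 ≤ δ := by
  have hjpos : (0 : ℝ) < j := by exact_mod_cast hj
  have hj2 : (0 : ℝ) < (j : ℝ) ^ 2 := by positivity
  have key : c * (1 / (j : ℝ)) + 2 * (1 / (j : ℝ)) ^ 2 = (c * j + 2) / (j : ℝ) ^ 2 := by
    rw [eq_div_iff hj2.ne']
    field_simp
    try ring
  rw [key, div_le_iff₀ hj2]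
  linarith

/-- `2 ≤ ε⁴ B` for `ε = 1/j`, `B = 2^{j+1}`, `j ≥ 16`. [folklore] -/
theorem two_le_eps_pow_four_mul (j : ℕ) (hj : 16 ≤ j) :
    (2 : ℝ) ≤ (1 / (j : ℝ)) ^ 4 * (2 : ℝ) ^ (j + 1) := by
  have hjpos : (0 : ℝ) < j := by exact_mod_cast (show 0 < j by omega)
  have hj4 : ((j : ℝ)) ^ 4 ≤ (2 : ℝ) ^ j := by exact_mod_cast pow_four_le_two_pow j hj
  have hj4pos : (0 : ℝ) < (j : ℝ) ^ 4 := by positivity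
  have h1 : (1 : ℝ) ≤ (2 : ℝ) ^ j / (j : ℝ) ^ 4 := by
    rw [le_div_iff₀ hj4pos]; linarith
  have e : (1 / (j : ℝ)) ^ 4 * (2 : ℝ) ^ (j + 1) = 2 * ((2 : ℝ) ^ j / (j : ℝ) ^ 4) := by
    ring
  rw [e]; linarith

/-! ## The two entropy hypotheses on the band (integer form) -/

set_option maxHeartbeats 800000 in
/-- **`H(Z_j) ≤ H(Y_j)` on the band** (`0 < q`, `p ≤ q`, `j ≥ 16`, `c₁(p/q) j + 2 ≤ j² δ(p/q)`):
the hypothesis `hY` of `omegaRect_one_tw_exact` at the counts bound by `h₁ … h₆`.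
[cite: CoppersmithWinograd1990, §8] [cite: AlmanDuanVassilevskaWilliamsXuXuZhou2025, §3.4] -/
theorem bandY (p q j n₁ n₂ n₃ n₄ n₆ : ℕ) (hq : 0 < q) (hpq : p ≤ q) (hj : 16 ≤ j)
    (hA : ((1 + (p : ℝ) / q) * Real.log (5 / 2) + (1 - (p : ℝ) / q) * Real.log 2) * j + 2 ≤
      (j : ℝ) ^ 2 * ((5 / 2 + (p : ℝ) / q) * Real.log 2 - 5 / 2 * Real.log (5 / 2)))
    (h₁ : n₁ = 3 * q * j + 2 * q) (h₂ : n₂ + (3 * q * j + 2 * q + 2 * p) = 2 * q * j * 2 ^ (j + 1))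
    (h₃ : n₃ = 3 * q * j + 2 * q + 2 * p) (h₄ : n₄ + 2 * q = q * j) (h₆ : n₆ = 2 * q * j) :
    shannonEntropy
        ![((n₁ : ℝ) + n₄ + (0 : ℕ)) /
            (n₁ + n₂ + n₃ + n₄ + 0 + n₆ : ℕ),
          ((n₂ : ℝ) + n₃) /
            (n₁ + n₂ + n₃ + n₄ + 0 + n₆ : ℕ),
          (n₆ : ℝ) / (n₁ + n₂ + n₃ + n₄ + 0 + n₆ : ℕ)] ≤
      shannonEntropy
        ![((n₃ : ℝ) + (0 : ℕ) + n₆) /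
            (n₁ + n₂ + n₃ + n₄ + 0 + n₆ : ℕ),
          ((n₁ : ℝ) + n₂) /
            (n₁ + n₂ + n₃ + n₄ + 0 + n₆ : ℕ),
          (n₄ : ℝ) / (n₁ + n₂ + n₃ + n₄ + 0 + n₆ : ℕ)] := by
  have hJ : (16 : ℝ) ≤ (j : ℝ) := by exact_mod_cast hj
  have hq' : (0 : ℝ) < q := by exact_mod_cast hq
  have hpq' : (p : ℝ) ≤ q := by exact_mod_cast hpq
  have hjpos : (0 : ℝ) < j := by linarith
  have hA' := band_eps (show 0 < j by omega) hA
  have hB4 := two_le_eps_pow_four_mul j hj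
  set B : ℝ := (2 : ℝ) ^ (j + 1) with hBdef
  set d : ℝ := B + 3 with hddef
  have hBpos : 0 < B := by positivity
  have hdpos : 0 < d := by positivity
  -- the counts as reals
  have c₁ : (n₁ : ℝ) = 3 * q * j + 2 * q := by rw [h₁]; push_cast; ring
  have c₂ : (n₂ : ℝ) = 2 * q * j * B - (3 * q * j + 2 * q + 2 * p) := by
    have h := congrArg (Nat.cast : ℕ → ℝ) h₂
    push_cast at h
    rw [hBdef]; linarith
  have c₃ : (n₃ : ℝ) = 3 * q * j + 2 * q + 2 * p := by rw [h₃]; push_cast; ring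
  have c₄ : (n₄ : ℝ) = q * j - 2 * q := by
    have h := congrArg (Nat.cast : ℕ → ℝ) h₄
    push_cast at h
    linarith
  have c₆ : (n₆ : ℝ) = 2 * q * j := by rw [h₆]; push_cast; ring
  have cN : ((n₁ + n₂ + n₃ + n₄ + 0 + n₆ : ℕ) : ℝ) = 2 * q * j * d := by
    push_cast; rw [c₁, c₂, c₃, c₄, c₆, hddef]; ring
  have hNpos : (0 : ℝ) < 2 * q * j * d := by positivity
  -- the parameters of the core lemma
  set κ : ℝ := (p : ℝ) / q with hκdef
  set ε : ℝ := 1 / (j : ℝ) with hεdef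
  have hκ0 : 0 ≤ κ := by positivity
  have hκ1 : κ ≤ 1 := by rw [hκdef, div_le_one hq']; exact hpq'
  have hε0 : 0 < ε := by positivity
  have hεle : ε ≤ 1 / 16 := one_div_le_one_div_of_le (by norm_num) hJ
  have hεJ : ε * j = 1 := by rw [hεdef]; field_simp
  have hlogB : Real.log B = ((j : ℝ) + 1) * Real.log 2 := by
    rw [hBdef, Real.log_pow]; push_cast; ring
  set α : ℝ := 5 / 2 + (1 + κ) * ε with hαdef
  set γ : ℝ := 1 / 2 - ε with hγdef
  set τ : ℝ := 3 + κ * ε with hτdef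
  -- the entries: `Z = (2, B, 1)/d`, `Y = (α, d − τ, γ)/d`
  have eZ0 : ((n₁ : ℝ) + n₄ + (0 : ℕ)) /
      (n₁ + n₂ + n₃ + n₄ + 0 + n₆ : ℕ) = 2 / d := by
    rw [cN, c₁, c₄]; push_cast; field_simp; ring
  have eZ1 : ((n₂ : ℝ) + n₃) /
      (n₁ + n₂ + n₃ + n₄ + 0 + n₆ : ℕ) = B / d := by
    rw [cN, c₂, c₃]; field_simp; ring
  have eZ2 : (n₆ : ℝ) / (n₁ + n₂ + n₃ + n₄ + 0 + n₆ : ℕ) =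
      1 / d := by
    rw [cN, c₆]; field_simp
  have eY0 : ((n₃ : ℝ) + (0 : ℕ) + n₆) /
      (n₁ + n₂ + n₃ + n₄ + 0 + n₆ : ℕ) = α / d := by
    rw [cN, c₃, c₆, hαdef, hκdef, hεdef]; push_cast; field_simp; ring
  have eY1 : ((n₁ : ℝ) + n₂) /
      (n₁ + n₂ + n₃ + n₄ + 0 + n₆ : ℕ) = 1 - τ / d := by
    rw [cN, c₁, c₂, hτdef, hκdef, hεdef]; field_simp; ring
  have eY2 : (n₄ : ℝ) / (n₁ + n₂ + n₃ + n₄ + 0 + n₆ : ℕ) =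
      γ / d := by
    rw [cN, c₄, hγdef, hεdef]; field_simp; try ring
  rw [eZ0, eZ1, eZ2, eY0, eY1, eY2]
  have hlog2 : 0 < Real.log 2 := Real.log_pos one_lt_two
  rw [shannonEntropy_def, shannonEntropy_def, div_le_div_iff_of_pos_right hlog2]
  simp only [Fin.sum_univ_three, Matrix.cons_val_zero, Matrix.cons_val_one, Matrix.cons_val_two,
    Matrix.head_cons, Matrix.tail_cons]
  exact bandCoreY κ ε j B d α γ τ hκ0 hκ1 hε0 hεle hεJ hA' hB4 hlogB hddef hαdef hγdef hτdef

set_option maxHeartbeats 800000 in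
/-- **`H(Z_j) ≤ H(X_j)` on the band** (same regime): the hypothesis `hX` of
`omegaRect_one_tw_exact` at the counts bound by `h₁ … h₆`.
[cite: CoppersmithWinograd1990, §8] [cite: AlmanDuanVassilevskaWilliamsXuXuZhou2025, §3.4] -/
theorem bandX (p q j n₁ n₂ n₃ n₄ n₆ : ℕ) (hq : 0 < q) (hpq : p ≤ q) (hj : 16 ≤ j)
    (hA : ((1 + (p : ℝ) / q) * Real.log (5 / 2) + (1 - (p : ℝ) / q) * Real.log 2) * j + 2 ≤
      (j : ℝ) ^ 2 * ((5 / 2 + (p : ℝ) / q) * Real.log 2 - 5 / 2 * Real.log (5 / 2)))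
    (h₁ : n₁ = 3 * q * j + 2 * q) (h₂ : n₂ + (3 * q * j + 2 * q + 2 * p) = 2 * q * j * 2 ^ (j + 1))
    (h₃ : n₃ = 3 * q * j + 2 * q + 2 * p) (h₄ : n₄ + 2 * q = q * j) (h₆ : n₆ = 2 * q * j) :
    shannonEntropy
        ![((n₁ : ℝ) + n₄ + (0 : ℕ)) /
            (n₁ + n₂ + n₃ + n₄ + 0 + n₆ : ℕ),
          ((n₂ : ℝ) + n₃) /
            (n₁ + n₂ + n₃ + n₄ + 0 + n₆ : ℕ),
          (n₆ : ℝ) / (n₁ + n₂ + n₃ + n₄ + 0 + n₆ : ℕ)] ≤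
      shannonEntropy
        ![((n₂ : ℝ) + n₄ + n₆) /
            (n₁ + n₂ + n₃ + n₄ + 0 + n₆ : ℕ),
          ((n₁ : ℝ) + n₃) /
            (n₁ + n₂ + n₃ + n₄ + 0 + n₆ : ℕ),
          ((0 : ℕ) : ℝ) / (n₁ + n₂ + n₃ + n₄ + 0 + n₆ : ℕ)] := by
  have hJ : (16 : ℝ) ≤ (j : ℝ) := by exact_mod_cast hj
  have hq' : (0 : ℝ) < q := by exact_mod_cast hq
  have hpq' : (p : ℝ) ≤ q := by exact_mod_cast hpq
  have hjpos : (0 : ℝ) < j := by linarith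
  have hA' := band_eps (show 0 < j by omega) hA
  have hB4 := two_le_eps_pow_four_mul j hj
  set B : ℝ := (2 : ℝ) ^ (j + 1) with hBdef
  set d : ℝ := B + 3 with hddef
  have hBpos : 0 < B := by positivity
  have hdpos : 0 < d := by positivity
  -- the counts as reals
  have c₁ : (n₁ : ℝ) = 3 * q * j + 2 * q := by rw [h₁]; push_cast; ring
  have c₂ : (n₂ : ℝ) = 2 * q * j * B - (3 * q * j + 2 * q + 2 * p) := by
    have h := congrArg (Nat.cast : ℕ → ℝ) h₂
    push_cast at h
    rw [hBdef]; linarith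
  have c₃ : (n₃ : ℝ) = 3 * q * j + 2 * q + 2 * p := by rw [h₃]; push_cast; ring
  have c₄ : (n₄ : ℝ) = q * j - 2 * q := by
    have h := congrArg (Nat.cast : ℕ → ℝ) h₄
    push_cast at h
    linarith
  have c₆ : (n₆ : ℝ) = 2 * q * j := by rw [h₆]; push_cast; ring
  have cN : ((n₁ + n₂ + n₃ + n₄ + 0 + n₆ : ℕ) : ℝ) = 2 * q * j * d := by
    push_cast; rw [c₁, c₂, c₃, c₄, c₆, hddef]; ring
  have hNpos : (0 : ℝ) < 2 * q * j * d := by positivity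
  -- the parameters of the core lemma
  set κ : ℝ := (p : ℝ) / q with hκdef
  set ε : ℝ := 1 / (j : ℝ) with hεdef
  have hκ0 : 0 ≤ κ := by positivity
  have hκ1 : κ ≤ 1 := by rw [hκdef, div_le_one hq']; exact hpq'
  have hε0 : 0 < ε := by positivity
  have hεle : ε ≤ 1 / 16 := one_div_le_one_div_of_le (by norm_num) hJ
  have hεJ : ε * j = 1 := by rw [hεdef]; field_simp
  have hlogB : Real.log B = ((j : ℝ) + 1) * Real.log 2 := by
    rw [hBdef, Real.log_pow]; push_cast; ring
  set σ : ℝ := 3 + (2 + κ) * ε with hσdef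
  -- the entries: `Z = (2, B, 1)/d`, `X = (d − σ, σ, 0)/d`
  have eZ0 : ((n₁ : ℝ) + n₄ + (0 : ℕ)) /
      (n₁ + n₂ + n₃ + n₄ + 0 + n₆ : ℕ) = 2 / d := by
    rw [cN, c₁, c₄]; push_cast; field_simp; ring
  have eZ1 : ((n₂ : ℝ) + n₃) /
      (n₁ + n₂ + n₃ + n₄ + 0 + n₆ : ℕ) = B / d := by
    rw [cN, c₂, c₃]; field_simp; ring
  have eZ2 : (n₆ : ℝ) / (n₁ + n₂ + n₃ + n₄ + 0 + n₆ : ℕ) =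
      1 / d := by
    rw [cN, c₆]; field_simp
  have eX0 : ((n₂ : ℝ) + n₄ + n₆) /
      (n₁ + n₂ + n₃ + n₄ + 0 + n₆ : ℕ) = 1 - σ / d := by
    rw [cN, c₂, c₄, c₆, hσdef, hκdef, hεdef]; field_simp; ring
  have eX1 : ((n₁ : ℝ) + n₃) /
      (n₁ + n₂ + n₃ + n₄ + 0 + n₆ : ℕ) = σ / d := by
    rw [cN, c₁, c₃, hσdef, hκdef, hεdef]; field_simp; ring
  have eX2 : ((0 : ℕ) : ℝ) / (n₁ + n₂ + n₃ + n₄ + 0 + n₆ : ℕ) =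
      0 := by simp
  rw [eZ0, eZ1, eZ2, eX0, eX1, eX2]
  have hlog2 : 0 < Real.log 2 := Real.log_pos one_lt_two
  rw [shannonEntropy_def, shannonEntropy_def, div_le_div_iff_of_pos_right hlog2]
  simp only [Fin.sum_univ_three, Matrix.cons_val_zero, Matrix.cons_val_one, Matrix.cons_val_two,
    Matrix.head_cons, Matrix.tail_cons, Real.negMulLog_zero, add_zero]
  exact bandCoreX κ ε j B d σ hκ0 hκ1 hε0 hεle hεJ hA' hB4 hlogB hddef hσdef

/-! ## The exact points of the pencil on the band -/

/-- **`ω(1, t_j, r_j) = 1 + r_j` for every pencil member on the band** (`≤`): `0 < q`, `p ≤ q`,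
`j ≥ 16`, `c₁(p/q)·j + 2 ≤ j²·δ(p/q)`; `t_j = j n₁/((j+1) n₃)`, `r_j = ((j+1) n₂ + n₁ + n₄)/((j+1) n₃)`
at the explicit counts — the exact six-type theorem with `bandX` / `bandY` as entropy hypotheses.
[cite: CoppersmithWinograd1990, §8] [cite: AlmanDuanVassilevskaWilliamsXuXuZhou2025, Thm. 3.2, §3.4] -/
theorem band_tight (p q j : ℕ) (hq : 0 < q) (hpq : p ≤ q) (hj : 16 ≤ j)
    (hA : ((1 + (p : ℝ) / q) * Real.log (5 / 2) + (1 - (p : ℝ) / q) * Real.log 2) * j + 2 ≤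
      (j : ℝ) ^ 2 * ((5 / 2 + (p : ℝ) / q) * Real.log 2 - 5 / 2 * Real.log (5 / 2))) :
    omegaRect ℂ 1
        (((j : ℝ) * ((3 * q * j + 2 * q : ℕ) : ℝ)) /
          (((j : ℝ) + 1) * ((3 * q * j + 2 * q + 2 * p : ℕ) : ℝ) + ((0 : ℕ) : ℝ)))
        ((((j : ℝ) + 1) * ((2 * q * j * 2 ^ (j + 1) - (3 * q * j + 2 * q + 2 * p) : ℕ) : ℝ) +
            ((3 * q * j + 2 * q : ℕ) : ℝ) + ((q * j - 2 * q : ℕ) : ℝ)) /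
          (((j : ℝ) + 1) * ((3 * q * j + 2 * q + 2 * p : ℕ) : ℝ) + ((0 : ℕ) : ℝ))) ≤
      1 + (((j : ℝ) + 1) * ((2 * q * j * 2 ^ (j + 1) - (3 * q * j + 2 * q + 2 * p) : ℕ) : ℝ) +
            ((3 * q * j + 2 * q : ℕ) : ℝ) + ((q * j - 2 * q : ℕ) : ℝ)) /
          (((j : ℝ) + 1) * ((3 * q * j + 2 * q + 2 * p : ℕ) : ℝ) + ((0 : ℕ) : ℝ)) := by
  have hc₂ : 2 * q * j * 2 ^ (j + 1) - (3 * q * j + 2 * q + 2 * p) + (3 * q * j + 2 * q + 2 * p) =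
      2 * q * j * 2 ^ (j + 1) := Nat.sub_add_cancel (le_cnt_aux p q j hpq (by omega))
  have hc₄ : q * j - 2 * q + 2 * q = q * j := Nat.sub_add_cancel (two_q_le q j (by omega))
  exact omegaRect_one_tw_exact j (3 * q * j + 2 * q)
    (2 * q * j * 2 ^ (j + 1) - (3 * q * j + 2 * q + 2 * p)) (3 * q * j + 2 * q + 2 * p)
    (q * j - 2 * q) 0 (2 * q * j) (cnt₆_pos q j hq (by omega)) (cnt_add₁₄ q j (by omega))
    (cnt_add₂₃ p q j hpq (by omega)) (cnt₃_pos p q j hq)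
    (bandX p q j _ _ _ _ _ hq hpq hj hA rfl hc₂ rfl hc₄ rfl)
    (bandY p q j _ _ _ _ _ hq hpq hj hA rfl hc₂ rfl hc₄ rfl)

/-! ## Size and defect of the exact points -/

/-- `r_j ≤ (2/3)·2^{j+1}` (`0 < q`): the ordinate is two thirds of the crude bound `r_le`.
[folklore] -/
theorem r_le_two_thirds (p q j n₁ n₂ n₃ n₄ : ℕ) (h₁ : n₁ = 3 * q * j + 2 * q)
    (h₂ : n₂ + (3 * q * j + 2 * q + 2 * p) = 2 * q * j * 2 ^ (j + 1))
    (h₃ : n₃ = 3 * q * j + 2 * q + 2 * p) (h₄ : n₄ + 2 * q = q * j) (hq : 0 < q) :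
    (((j : ℝ) + 1) * n₂ + n₁ + n₄) / (((j : ℝ) + 1) * n₃ + ((0 : ℕ) : ℝ)) ≤
      2 / 3 * (2 : ℝ) ^ (j + 1) := by
  have hq' : (0 : ℝ) < q := by exact_mod_cast hq
  rw [rEq p q j n₁ n₂ n₃ n₄ h₁ h₂ h₃ h₄, div_le_iff₀ (by positivity)]
  have hB : (0 : ℝ) ≤ (2 : ℝ) ^ (j + 1) := by positivity
  have hj0 : (0 : ℝ) ≤ j := Nat.cast_nonneg _
  have hp0 : (0 : ℝ) ≤ p := Nat.cast_nonneg _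
  have e : 2 / 3 * (2 : ℝ) ^ (j + 1) * (((j : ℝ) + 1) * (3 * q * j + 2 * q + 2 * p)) -
      (((j : ℝ) + 1) * (2 * q * j * (2 : ℝ) ^ (j + 1) - (3 * q * j + 2 * q + 2 * p)) +
        (3 * q * j + 2 * q) + (q * j - 2 * q)) =
      2 / 3 * (2 : ℝ) ^ (j + 1) * (((j : ℝ) + 1) * (2 * q + 2 * p)) +
        (((j : ℝ) + 1) * (3 * q * j + 2 * q + 2 * p) - 4 * q * j) := by ring
  have h1 : (0 : ℝ) ≤ 2 / 3 * (2 : ℝ) ^ (j + 1) * (((j : ℝ) + 1) * (2 * q + 2 * p)) := by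
    positivity
  have h2 : (0 : ℝ) ≤ ((j : ℝ) + 1) * (3 * q * j + 2 * q + 2 * p) - 4 * q * j := by
    nlinarith [hq'.le, hj0, hp0, mul_nonneg hq'.le (mul_nonneg hj0 hj0)]
  linarith [e, h1, h2]

/-- `0 ≤ t_j`. [folklore] -/
theorem t_nonneg (j n₁ n₃ : ℕ) :
    0 ≤ ((j : ℝ) * n₁) / (((j : ℝ) + 1) * n₃ + ((0 : ℕ) : ℝ)) := by positivity

/-- `t_j < 1` (`0 < q`). [folklore] -/
theorem t_lt_one (p q j n₁ n₃ : ℕ) (h₁ : n₁ = 3 * q * j + 2 * q)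
    (h₃ : n₃ = 3 * q * j + 2 * q + 2 * p) (hq : 0 < q) :
    ((j : ℝ) * n₁) / (((j : ℝ) + 1) * n₃ + ((0 : ℕ) : ℝ)) < 1 := by
  have hq' : (0 : ℝ) < q := by exact_mod_cast hq
  have h : 0 < 1 - ((j : ℝ) * n₁) / (((j : ℝ) + 1) * n₃ + ((0 : ℕ) : ℝ)) := by
    rw [one_sub_t p q j n₁ n₃ h₁ h₃ hq]; positivity
  linarith

/-- **Defect of an exact point of the pencil: `(1 − t_j) log r_j ≤ ((3q+2p)/(3q)) log 2 = log θ(p/q)`**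
(`0 < q`, `p ≤ q`, `j ≥ 3`): `log r_j ≤ (j+1) log 2` and
`(1 − t_j)(j+1) = ((3q+2p) j + 2q + 2p)/(3qj + 2q + 2p) ≤ (3q+2p)/(3q)`. [folklore] -/
theorem band_defect_le (p q j n₁ n₂ n₃ n₄ : ℕ) (h₁ : n₁ = 3 * q * j + 2 * q)
    (h₂ : n₂ + (3 * q * j + 2 * q + 2 * p) = 2 * q * j * 2 ^ (j + 1))
    (h₃ : n₃ = 3 * q * j + 2 * q + 2 * p) (h₄ : n₄ + 2 * q = q * j) (hq : 0 < q) (hpq : p ≤ q)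
    (hj : 3 ≤ j) :
    (1 - ((j : ℝ) * n₁) / (((j : ℝ) + 1) * n₃ + ((0 : ℕ) : ℝ))) *
        Real.log ((((j : ℝ) + 1) * n₂ + n₁ + n₄) / (((j : ℝ) + 1) * n₃ + ((0 : ℕ) : ℝ))) ≤
      (3 * (q : ℝ) + 2 * p) / (3 * q) * Real.log 2 := by
  have hq' : (0 : ℝ) < q := by exact_mod_cast hq
  have hp0 : (0 : ℝ) ≤ p := Nat.cast_nonneg _
  have hj0 : (0 : ℝ) ≤ j := Nat.cast_nonneg _
  have hr1 := one_le_r p q j n₁ n₂ n₃ n₄ h₁ h₂ h₃ h₄ hq hpq hj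
  have hrle := r_le p q j n₁ n₂ n₃ n₄ h₁ h₂ h₃ h₄ hq (by omega)
  have hlog : Real.log ((((j : ℝ) + 1) * n₂ + n₁ + n₄) / (((j : ℝ) + 1) * n₃ + ((0 : ℕ) : ℝ))) ≤
      ((j : ℝ) + 1) * Real.log 2 := by
    have h := Real.log_le_log (by linarith) hrle
    have e : Real.log ((2 : ℝ) ^ (j + 1)) = ((j : ℝ) + 1) * Real.log 2 := by
      rw [Real.log_pow]; push_cast; ring
    rw [e] at h
    exact h
  have h1t : 0 ≤ 1 - ((j : ℝ) * n₁) / (((j : ℝ) + 1) * n₃ + ((0 : ℕ) : ℝ)) := by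
    rw [one_sub_t p q j n₁ n₃ h₁ h₃ hq]; positivity
  calc (1 - ((j : ℝ) * n₁) / (((j : ℝ) + 1) * n₃ + ((0 : ℕ) : ℝ))) *
        Real.log ((((j : ℝ) + 1) * n₂ + n₁ + n₄) / (((j : ℝ) + 1) * n₃ + ((0 : ℕ) : ℝ)))
        ≤ (1 - ((j : ℝ) * n₁) / (((j : ℝ) + 1) * n₃ + ((0 : ℕ) : ℝ))) *
          (((j : ℝ) + 1) * Real.log 2) := mul_le_mul_of_nonneg_left hlog h1t
    _ = ((3 * (q : ℝ) + 2 * p) * j + 2 * q + 2 * p) / (3 * q * j + 2 * q + 2 * p) * Real.log 2 := by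
        rw [one_sub_t p q j n₁ n₃ h₁ h₃ hq]
        have h : (0 : ℝ) < 3 * q * j + 2 * q + 2 * p := by positivity
        field_simp
    _ ≤ (3 * (q : ℝ) + 2 * p) / (3 * q) * Real.log 2 := by
        apply mul_le_mul_of_nonneg_right _ (Real.log_pos one_lt_two).le
        rw [div_le_div_iff₀ (by positivity) (by positivity)]
        nlinarith [hq'.le, hp0, hj0, mul_nonneg hp0 hp0, mul_nonneg hp0 hq'.le]

end Summit.MatrixMultiplication.MatrixMultiplication.Theorems.SaturationLadderCornerBand
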